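import Summits.Ventures.HodgeRepro2.T6B3Hyp

/-!
# T6B3Toy — Tier 6 (README §10.5(ii)(c)–(d)), sub-goal B3: the displays are jointly satisfiable

Proof lane, a HELPER for the referees' non-vacuity protocol (TARGET-T6.md §7(f)): a kernel-checked TOY DATUM
`toyShape K c χEF : Liu.AlbaneseH1Shape K c χEF` (rank 3, one representation, every multiplicity and every
dimension 1, one level, the trivial orbit relation, the trivial monoid of isogeny classes) on which the four
B3 displays over the datum (`Hyp.Liu2021_Prop4_13`, `Hyp.Liu2021_Thm4_18_iso`, `Hyp.Liu2021_Thm4_18_1`,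
`Hyp.Liu2021_Cor4_20`) and the B5 interface Prop `Liu.OscillatorAdmissibleShape` hold SIMULTANEOUSLY, given
one conjugate symplectic character μ₀ of weight one (what the fifth display, DR15 Lemma 3.5, supplies for
every CM type). Nothing here is mathematics of the route: the toy records that the hypotheses of `B3_main`
are not contradictory and that its carriers are inhabited (owner file route/T6-B3-t6-p6.md §7).
Also provided: `Liu.OneCharacter.one`, the trivial character of `E^1\(𝔸_E^∞)^1` (Liu Def. 4.11, χ = 1 —
TIER4 B2(d) «ν = 1 allowed»). §8(d): uses an L-value-free non-vanishing device: NO.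
-/

namespace Summit.Ventures.HodgeRepro2.T6

open Summit.Ventures.HodgeRepro2 ShimuraData

universe u

variable (K : Type u) [Field K] [NumberField K] [NumberField.IsCMField K]
  (c : Liu.IdeleConjugation K)

/-- The trivial automorphic character of `E^1\(𝔸_E^∞)^1` (Liu Def. 4.11 third bullet; «ν = 1 allowed»). -/
noncomputable def Liu.OneCharacter.one : Liu.OneCharacter K c where
  toFun := 1
  continuous := continuous_const
  principal := fun _ _ => rfl

variable (χEF : Liu.QuadraticCharacter K c)

/-- The toy datum: one representation, all multiplicities and dimensions `1`, one level. -/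
noncomputable def toyShape : Liu.AlbaneseH1Shape K c χEF where
  rank := 3
  Rep := Unit
  decEqRep := inferInstance
  osc := fun _ => ()
  mult := fun _ _ => 1
  Level := Unit
  levelLattice := inferInstance
  IsSmall := fun _ => True
  isSmall_of_le := fun _ h => h
  dimInv := fun _ _ => 1
  dimInv_anti := by intros; exact le_rfl
  galOrbit := fun _ _ => True
  galOrbit_equivalence := ⟨fun _ => trivial, fun _ => trivial, fun _ _ => trivial⟩
  IsogClass := Unit
  commMonoid := inferInstance
  albanese := fun _ => ()
  cmVariety := fun _ => ()
  homDim := fun _ _ => 1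
  omegaInvDim := fun _ _ => 1

/-- An admissible triple with a prescribed weight-one conjugate symplectic first component (the Def. 4.12
witness `e` from p2's `exists_isMuAdmissibleRep`, the trivial third component). -/
theorem exists_admissible_of_isWeightOneConjugateSymplectic {μ : Liu.AutomorphicCharacter K}
    (hμ : Liu.IsWeightOneConjugateSymplectic K c χEF μ) :
    ∃ t : Liu.OscillatorTriple K c χEF, t.μ = μ ∧ Liu.OscillatorTriple.IsAdmissible K t := by
  obtain ⟨hs, Φ, hΦ, hw⟩ := hμ
  obtain ⟨e, he⟩ := Liu.exists_isMuAdmissibleRep K hΦ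
  exact ⟨{ μ := μ, μ_symplectic := hs, e := e, e_mem := he.1, χ := Liu.OneCharacter.one K c }, rfl,
    Φ, hΦ, hw, he⟩

/-- JOINT SATISFIABILITY: given one conjugate symplectic character of weight one, the toy datum satisfies
the four datum displays of B3 and the B5 interface Prop at once, with rank `3`. -/
theorem displays_jointly_satisfiable {μ₀ : Liu.AutomorphicCharacter K}
    (hμ₀ : Liu.IsWeightOneConjugateSymplectic K c χEF μ₀) :
    ∃ S : Liu.AlbaneseH1Shape K c χEF, 3 ≤ S.rank ∧ Hyp.Liu2021_Prop4_13 S ∧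
      Hyp.Liu2021_Thm4_18_iso S ∧ Hyp.Liu2021_Thm4_18_1 S ∧ Hyp.Liu2021_Cor4_20 S ∧
      Liu.OscillatorAdmissibleShape K S := by
  classical
  obtain ⟨t₀, ht₀μ, ht₀⟩ := exists_admissible_of_isWeightOneConjugateSymplectic K c χEF hμ₀
  -- for every μ, a finite set of admissible triples with first component μ, non-empty when one exists
  let Tf : Liu.AutomorphicCharacter K → Finset (Liu.OscillatorTriple K c χEF) := fun μ =>
    if h : ∃ t : Liu.OscillatorTriple K c χEF, t.μ = μ ∧ Liu.OscillatorTriple.IsAdmissible K t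
      then {h.choose} else ∅
  refine ⟨toyShape K c χEF, by simp [toyShape], ?_, ?_, ?_, ?_, ?_⟩
  · -- Prop. 4.13: multiplicity one, exhaustion
    exact fun _ => ⟨fun _ _ _ => rfl, fun _ _ _ => ⟨t₀, ht₀, rfl⟩⟩
  · -- Thm. 4.18 (isomorphism): 1 ≤ 1
    exact fun _ _ _ _ => le_rfl
  · -- Thm. 4.18(1): 1 = 1
    exact fun _ _ _ _ => rfl
  · -- Cor. 4.20 at the unique level
    refine fun _ L _ => ⟨{μ₀}, Tf, ?_, ?_, ?_, ?_, ?_, ?_⟩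
    · intro μ hμ
      rw [Finset.mem_singleton] at hμ
      exact hμ ▸ hμ₀
    · intro μ t ht
      simp only [Tf] at ht
      split_ifs at ht with h
      · rw [Finset.mem_singleton] at ht
        exact ht ▸ h.choose_spec
      · exact absurd ht (Finset.notMem_empty t)
    · intro μ t ht hμ _
      have h : ∃ t : Liu.OscillatorTriple K c χEF, t.μ = μ ∧ Liu.OscillatorTriple.IsAdmissible K t :=
        ⟨t, hμ, ht⟩
      refine Finset.mem_image.mpr ⟨h.choose, ?_, rfl⟩
      simp only [Tf, dif_pos h, Finset.mem_singleton]
    · intro μ hμ μ' hμ' _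
      rw [Finset.mem_singleton] at hμ hμ'
      exact hμ.trans hμ'.symm
    · intro μ _ _
      exact ⟨μ₀, Finset.mem_singleton_self _, trivial⟩
    · rfl
  · -- the B5 interface Prop: non-zero invariants at the unique level
    exact fun _ _ => ⟨(), trivial, Nat.one_pos⟩

end Summit.Ventures.HodgeRepro2.T6
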